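import Summits.Ventures.HSemireg.WedgeHankelRecurrenceGaussMarkovMonotone

/-!
# Venture HSemireg — **COROLLARIES OF A. MARKOV'S THEOREM**: a non-increasing density moves every Gauss node to the LEFT; a constant density does not move them; the CHRISTOFFEL factor `(x − c)`
# (`c` left of the support) and the STIELTJES factors `x^s` (positive support) move every node strictly to the right, the GERONIMUS factor `1∕(x − c)` strictly to the left; adding mass to
# the LEFTMOST (resp. RIGHTMOST) atom moves every node to the left (resp. right)

HONEST FRAMING. Part of the Lean index of the computation cell `pub-hsemireg` (seat p10 gen 44, Sunday typer «UNIFORM-IN-n»).  Finite sums of real numbers and real polynomials only; no variety,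
no cohomology theory, no sheaf, no Ext group and no semiregularity map is constructed here; nothing here says that HC / HC_CM / HC_AV holds; no Literature fact (unproved `Prop`) is declared or
used.  Custodian versions as in `WedgeHankelSiegelIdeal` (1/3).
SOURCES (cited).  A. Markov, Math. Ann. 27 (1886) 177–182; G. Szegő, *Orthogonal Polynomials*, Thm 6.12.1 ∕ 6.12.2 and §6.21 (applications of Markov's theorem); M. E. H. Ismail, *Classical and
Quantum Orthogonal Polynomials* (2005) §7.1; E. B. Christoffel (1858), Ja. L. Geronimus (1940), V. B. Uvarov (1969) for the three modifications of the measure (typed as N304 ∕ N307 ∕ N305).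
PROOF TYPED HERE.  All items are N320 `markov_monotone` ∕ `markov_strictMono` for a particular density: `g⁻¹` on the base measure `gν` (antitone case), `w − c`, `(w − c)⁻¹`, `w^s`, and the
two-valued density `M'∕M` at an extreme atom, `1` elsewhere.
DEDUP DISCLOSURE (`rg -n 'markov_antitone|christoffel_nodes|geronimus_nodes|stieltjes_nodes_lt|endMass' Summits/Ventures/HSemireg`, 2026-09-03): N268 `gauss_kernel_nodes_interlace` gives, for the
Christoffel factor, the INTERLACING `v_i < w_i < v_{i+1}` of two `(t+2)`-point rules by a counting argument; item (3) below re-derives its first half for `(t+1)`-point rules from Markov's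
theorem (different route, stated for the density `(w − c)·ν` in the present normalisation); N267 `gauss_nodes_interlace_stieltjes` is the analogous interlacing for the factor `x`.  The rest is
new.  The 8 names below: 0 hits tree-wide.

WHAT IS IN THE TREE.  N320 `markov_monotone`, `markov_strictMono`.
THIS FILE (namespace `Summit.Ventures.HSemireg.Wedge.HankelOuter` continued; CHAINED on N320 (import); 0 definitions):
* §1086 **`markov_antitone`** (`g > 0` non-increasing along `w` ⇒ `y_k ≤ x_k`), `markov_strictAnti` (strict), `gauss_nodes_eq_of_const_density` (`g ≡ κ > 0` ⇒ `y = x`),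
  **`christoffel_factor_nodes_lt`** (density `w − c`, `c < w_l` ⇒ `x_k < y_k`), **`geronimus_factor_nodes_lt`** (density `(w − c)⁻¹`, `c < w_l` ⇒ `y_k < x_k`), `stieltjes_factor_nodes_lt`
  (density `w^s`, `s ≥ 1`, `0 < w_l` ⇒ `x_k < y_k`), **`leftEnd_mass_nodes_le`** (weights `M ≤ M'` at an atom `c` left of all other nodes ⇒ `y_k ≤ x_k`), `rightEnd_mass_nodes_le`
  (`c` right of all other nodes ⇒ `x_k ≤ y_k`).
CAVEATS.  Discrete positive measures; `(t+1)`-point Gauss rules (moments to degree `2t + 1`); the strict items need `N ≥ t + 2` nodes.  Nothing Ext-side.  New names only.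
-/

open Module Polynomial
open scoped Matrix Polynomial

namespace Summit.Ventures.HSemireg.Wedge.HankelOuter

/-! ## §1086. Corollaries of Markov's theorem -/

/-- **A NON-INCREASING DENSITY MOVES EVERY NODE TO THE LEFT: `g > 0` non-increasing along `w` ⇒ `y_k ≤ x_k`** (Markov's theorem for the density `g⁻¹` on the base measure `gν`).
[Szegő Thm 6.12.1; this file, §1086] -/
theorem markov_antitone {t N : ℕ} {ν w g : Fin N → ℝ} (hν : ∀ l, 0 < ν l) (hw : Function.Injective w) (hN : t + 1 ≤ N)
    (hg : ∀ l, 0 < g l) (hgw : ∀ l l', w l < w l' → g l' ≤ g l)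
    {μ x μ' y : Fin (t + 1) → ℝ} (hx : StrictMono x) (hy : StrictMono y)
    (hmom : ∀ p, p ≤ 2 * t + 1 → ∑ j, μ j * x j ^ p = ∑ l, ν l * w l ^ p)
    (hmom' : ∀ p, p ≤ 2 * t + 1 → ∑ j, μ' j * y j ^ p = ∑ l, (g l * ν l) * w l ^ p) (k : Fin (t + 1)) :
    y k ≤ x k := by
  have hmom'' : ∀ p, p ≤ 2 * t + 1 → ∑ j, μ j * x j ^ p = ∑ l, ((g l)⁻¹ * (g l * ν l)) * w l ^ p := fun p hp => by
    rw [hmom p hp]; exact Finset.sum_congr rfl fun l _ => by rw [inv_mul_cancel_left₀ (hg l).ne']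
  exact markov_monotone (fun l => mul_pos (hg l) (hν l)) hw hN (fun l => inv_pos.2 (hg l))
    (fun l l' h => (inv_le_inv₀ (hg l) (hg l')).2 (hgw l l' h)) hy hx hmom' hmom'' k

/-- **Strict form: `g > 0` STRICTLY decreasing along `w`, `N ≥ t + 2` ⇒ `y_k < x_k`.** [Szegő Thm 6.12.2; this file, §1086] -/
theorem markov_strictAnti {t N : ℕ} {ν w g : Fin N → ℝ} (hν : ∀ l, 0 < ν l) (hw : Function.Injective w) (hN : t + 2 ≤ N)
    (hg : ∀ l, 0 < g l) (hgw : ∀ l l', w l < w l' → g l' < g l)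
    {μ x μ' y : Fin (t + 1) → ℝ} (hx : StrictMono x) (hy : StrictMono y)
    (hmom : ∀ p, p ≤ 2 * t + 1 → ∑ j, μ j * x j ^ p = ∑ l, ν l * w l ^ p)
    (hmom' : ∀ p, p ≤ 2 * t + 1 → ∑ j, μ' j * y j ^ p = ∑ l, (g l * ν l) * w l ^ p) (k : Fin (t + 1)) :
    y k < x k := by
  have hmom'' : ∀ p, p ≤ 2 * t + 1 → ∑ j, μ j * x j ^ p = ∑ l, ((g l)⁻¹ * (g l * ν l)) * w l ^ p := fun p hp => by
    rw [hmom p hp]; exact Finset.sum_congr rfl fun l _ => by rw [inv_mul_cancel_left₀ (hg l).ne']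
  exact markov_strictMono (fun l => mul_pos (hg l) (hν l)) hw hN (fun l => inv_pos.2 (hg l))
    (fun l l' h => (inv_lt_inv₀ (hg l) (hg l')).2 (hgw l l' h)) hy hx hmom' hmom'' k

/-- **A CONSTANT DENSITY DOES NOT MOVE THE NODES: `ν' = κν`, `κ > 0` ⇒ `y = x`.** [this file, §1086] -/
theorem gauss_nodes_eq_of_const_density {t N : ℕ} {ν w : Fin N → ℝ} (hν : ∀ l, 0 < ν l) (hw : Function.Injective w) (hN : t + 1 ≤ N) {κ : ℝ} (hκ : 0 < κ)
    {μ x μ' y : Fin (t + 1) → ℝ} (hx : StrictMono x) (hy : StrictMono y)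
    (hmom : ∀ p, p ≤ 2 * t + 1 → ∑ j, μ j * x j ^ p = ∑ l, ν l * w l ^ p)
    (hmom' : ∀ p, p ≤ 2 * t + 1 → ∑ j, μ' j * y j ^ p = ∑ l, (κ * ν l) * w l ^ p) : y = x :=
  funext fun k => le_antisymm
    (markov_antitone (g := fun _ => κ) hν hw hN (fun _ => hκ) (fun _ _ _ => le_rfl) hx hy hmom hmom' k)
    (markov_monotone (g := fun _ => κ) hν hw hN (fun _ => hκ) (fun _ _ _ => le_rfl) hx hy hmom hmom' k)

/-- **THE CHRISTOFFEL FACTOR MOVES EVERY NODE STRICTLY RIGHT: `ν' = (w − c)ν` with `c < w_l` for all `l`, `N ≥ t + 2` ⇒ `x_k < y_k`** (the `(t+1)`-point Gauss nodes of `(x − c)dν` — the zeros of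
the kernel polynomial `K_{t+1}(x, c)` by N304 — lie to the right of those of `dν`; cf. the interlacing N268). [Szegő §6.21 (2); Christoffel 1858; this file, §1086] -/
theorem christoffel_factor_nodes_lt {t N : ℕ} {ν w : Fin N → ℝ} (hν : ∀ l, 0 < ν l) (hw : Function.Injective w) (hN : t + 2 ≤ N) {c : ℝ} (hcw : ∀ l, c < w l)
    {μ x μ' y : Fin (t + 1) → ℝ} (hx : StrictMono x) (hy : StrictMono y)
    (hmom : ∀ p, p ≤ 2 * t + 1 → ∑ j, μ j * x j ^ p = ∑ l, ν l * w l ^ p)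
    (hmom' : ∀ p, p ≤ 2 * t + 1 → ∑ j, μ' j * y j ^ p = ∑ l, ((w l - c) * ν l) * w l ^ p) (k : Fin (t + 1)) :
    x k < y k :=
  markov_strictMono (g := fun l => w l - c) hν hw hN (fun l => sub_pos.2 (hcw l)) (fun _ _ h => sub_lt_sub_right h c) hx hy hmom hmom' k

/-- **THE GERONIMUS FACTOR MOVES EVERY NODE STRICTLY LEFT: `ν' = (w − c)⁻¹ν` with `c < w_l` for all `l`, `N ≥ t + 2` ⇒ `y_k < x_k`.** [Szegő §6.21; Geronimus 1940; this file, §1086] -/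
theorem geronimus_factor_nodes_lt {t N : ℕ} {ν w : Fin N → ℝ} (hν : ∀ l, 0 < ν l) (hw : Function.Injective w) (hN : t + 2 ≤ N) {c : ℝ} (hcw : ∀ l, c < w l)
    {μ x μ' y : Fin (t + 1) → ℝ} (hx : StrictMono x) (hy : StrictMono y)
    (hmom : ∀ p, p ≤ 2 * t + 1 → ∑ j, μ j * x j ^ p = ∑ l, ν l * w l ^ p)
    (hmom' : ∀ p, p ≤ 2 * t + 1 → ∑ j, μ' j * y j ^ p = ∑ l, ((w l - c)⁻¹ * ν l) * w l ^ p) (k : Fin (t + 1)) :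
    y k < x k :=
  markov_strictAnti (g := fun l => (w l - c)⁻¹) hν hw hN (fun l => inv_pos.2 (sub_pos.2 (hcw l)))
    (fun l l' h => (inv_lt_inv₀ (sub_pos.2 (hcw l')) (sub_pos.2 (hcw l))).2 (sub_lt_sub_right h c)) hx hy hmom hmom' k

/-- **THE STIELTJES FACTORS `x^s` (`s ≥ 1`) ON A POSITIVE SUPPORT MOVE EVERY NODE STRICTLY RIGHT: `0 < w_l`, `ν' = w^s ν`, `N ≥ t + 2` ⇒ `x_k < y_k`.** [Szegő §6.21; this file, §1086] -/
theorem stieltjes_factor_nodes_lt {t N : ℕ} {ν w : Fin N → ℝ} (hν : ∀ l, 0 < ν l) (hw : Function.Injective w) (hN : t + 2 ≤ N) (hw0 : ∀ l, 0 < w l) {s : ℕ} (hs : s ≠ 0)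
    {μ x μ' y : Fin (t + 1) → ℝ} (hx : StrictMono x) (hy : StrictMono y)
    (hmom : ∀ p, p ≤ 2 * t + 1 → ∑ j, μ j * x j ^ p = ∑ l, ν l * w l ^ p)
    (hmom' : ∀ p, p ≤ 2 * t + 1 → ∑ j, μ' j * y j ^ p = ∑ l, (w l ^ s * ν l) * w l ^ p) (k : Fin (t + 1)) :
    x k < y k :=
  markov_strictMono (g := fun l => w l ^ s) hν hw hN (fun l => pow_pos (hw0 l) s) (fun l _ h => pow_lt_pow_left₀ h (hw0 l).le hs) hx hy hmom hmom' k

/-- **MASS ADDED TO THE LEFTMOST ATOM MOVES EVERY NODE TO THE LEFT**: on the nodes `c, w_0, …, w_{N−1}` with `c < w_l`, the measures with weights `(M, ν)` and `(M', ν)`, `0 < M ≤ M'`, have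
`(t+1)`-point Gauss nodes `y_k ≤ x_k` (density `M'∕M` at `c`, `1` elsewhere — non-increasing along the nodes). [Szegő Thm 6.12.1; Uvarov 1969; this file, §1086] -/
theorem leftEnd_mass_nodes_le {t N : ℕ} {ν w : Fin N → ℝ} (hν : ∀ l, 0 < ν l) (hw : Function.Injective w) (hN : t ≤ N) {c M M' : ℝ} (hcw : ∀ l, c < w l)
    (hM : 0 < M) (hMM' : M ≤ M')
    {μ x μ' y : Fin (t + 1) → ℝ} (hx : StrictMono x) (hy : StrictMono y)
    (hmom : ∀ p, p ≤ 2 * t + 1 → ∑ j, μ j * x j ^ p = ∑ l : Fin (N + 1), (Fin.cons M ν : Fin (N + 1) → ℝ) l * (Fin.cons c w : Fin (N + 1) → ℝ) l ^ p)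
    (hmom' : ∀ p, p ≤ 2 * t + 1 → ∑ j, μ' j * y j ^ p = ∑ l : Fin (N + 1), (Fin.cons M' ν : Fin (N + 1) → ℝ) l * (Fin.cons c w : Fin (N + 1) → ℝ) l ^ p)
    (k : Fin (t + 1)) : y k ≤ x k := by
  have hν₁ : ∀ l : Fin (N + 1), 0 < (Fin.cons M ν : Fin (N + 1) → ℝ) l := fun l => by
    refine Fin.cases ?_ (fun i => ?_) l
    · simpa using hM
    · simpa using hν i
  have hw₁ : Function.Injective (Fin.cons c w : Fin (N + 1) → ℝ) := by
    refine Fin.cons_injective_iff.2 ⟨?_, hw⟩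
    intro h
    obtain ⟨l, hl⟩ := Set.mem_range.1 h
    exact (hcw l).ne' hl
  set g : Fin (N + 1) → ℝ := Fin.cons (M' / M) (fun _ => 1) with hg
  have hgpos : ∀ l, 0 < g l := fun l => by
    refine Fin.cases ?_ (fun i => ?_) l
    · simpa [hg] using div_pos (hM.trans_le hMM') hM
    · simp [hg]
  have hganti : ∀ l l' : Fin (N + 1), (Fin.cons c w : Fin (N + 1) → ℝ) l < (Fin.cons c w : Fin (N + 1) → ℝ) l' → g l' ≤ g l := by
    intro l l' hll'
    have hl' : l' ≠ 0 := by
      rintro rfl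
      refine absurd hll' (not_lt.2 ?_)
      refine Fin.cases ?_ (fun i => ?_) l
      · simp
      · simpa using (hcw i).le
    obtain ⟨i', rfl⟩ := Fin.exists_succ_eq.2 hl'
    refine Fin.cases ?_ (fun i => ?_) l
    · simpa [hg] using (one_le_div hM).2 hMM'
    · simp [hg]
  have hmom'' : ∀ p, p ≤ 2 * t + 1 → ∑ j, μ' j * y j ^ p = ∑ l : Fin (N + 1), (g l * (Fin.cons M ν : Fin (N + 1) → ℝ) l) * (Fin.cons c w : Fin (N + 1) → ℝ) l ^ p := by
    intro p hp
    rw [hmom' p hp]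
    refine Finset.sum_congr rfl fun l _ => ?_
    congr 1
    refine Fin.cases ?_ (fun i => ?_) l
    · simp [hg, div_mul_cancel₀ M' hM.ne']
    · simp [hg]
  exact markov_antitone hν₁ hw₁ (by omega) hgpos hganti hx hy hmom hmom'' k

/-- **MASS ADDED TO THE RIGHTMOST ATOM MOVES EVERY NODE TO THE RIGHT**: on the nodes `c, w_0, …, w_{N−1}` with `w_l < c`, weights `(M, ν)` and `(M', ν)`, `0 < M ≤ M'` ⇒ `x_k ≤ y_k`.
[Szegő Thm 6.12.1; Uvarov 1969; this file, §1086] -/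
theorem rightEnd_mass_nodes_le {t N : ℕ} {ν w : Fin N → ℝ} (hν : ∀ l, 0 < ν l) (hw : Function.Injective w) (hN : t ≤ N) {c M M' : ℝ} (hwc : ∀ l, w l < c)
    (hM : 0 < M) (hMM' : M ≤ M')
    {μ x μ' y : Fin (t + 1) → ℝ} (hx : StrictMono x) (hy : StrictMono y)
    (hmom : ∀ p, p ≤ 2 * t + 1 → ∑ j, μ j * x j ^ p = ∑ l : Fin (N + 1), (Fin.cons M ν : Fin (N + 1) → ℝ) l * (Fin.cons c w : Fin (N + 1) → ℝ) l ^ p)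
    (hmom' : ∀ p, p ≤ 2 * t + 1 → ∑ j, μ' j * y j ^ p = ∑ l : Fin (N + 1), (Fin.cons M' ν : Fin (N + 1) → ℝ) l * (Fin.cons c w : Fin (N + 1) → ℝ) l ^ p)
    (k : Fin (t + 1)) : x k ≤ y k := by
  have hν₁ : ∀ l : Fin (N + 1), 0 < (Fin.cons M ν : Fin (N + 1) → ℝ) l := fun l => by
    refine Fin.cases ?_ (fun i => ?_) l
    · simpa using hM
    · simpa using hν i
  have hw₁ : Function.Injective (Fin.cons c w : Fin (N + 1) → ℝ) := by
    refine Fin.cons_injective_iff.2 ⟨?_, hw⟩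
    intro h
    obtain ⟨l, hl⟩ := Set.mem_range.1 h
    exact (hwc l).ne hl
  set g : Fin (N + 1) → ℝ := Fin.cons (M' / M) (fun _ => 1) with hg
  have hgpos : ∀ l, 0 < g l := fun l => by
    refine Fin.cases ?_ (fun i => ?_) l
    · simpa [hg] using div_pos (hM.trans_le hMM') hM
    · simp [hg]
  have hgmono : ∀ l l' : Fin (N + 1), (Fin.cons c w : Fin (N + 1) → ℝ) l < (Fin.cons c w : Fin (N + 1) → ℝ) l' → g l ≤ g l' := by
    intro l l' hll'
    have hl : l ≠ 0 := by
      rintro rfl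
      refine absurd hll' (not_lt.2 ?_)
      refine Fin.cases ?_ (fun i => ?_) l'
      · simp
      · simpa using (hwc i).le
    obtain ⟨i, rfl⟩ := Fin.exists_succ_eq.2 hl
    refine Fin.cases ?_ (fun i' => ?_) l'
    · simpa [hg] using (one_le_div hM).2 hMM'
    · simp [hg]
  have hmom'' : ∀ p, p ≤ 2 * t + 1 → ∑ j, μ' j * y j ^ p = ∑ l : Fin (N + 1), (g l * (Fin.cons M ν : Fin (N + 1) → ℝ) l) * (Fin.cons c w : Fin (N + 1) → ℝ) l ^ p := by
    intro p hp
    rw [hmom' p hp]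
    refine Finset.sum_congr rfl fun l _ => ?_
    congr 1
    refine Fin.cases ?_ (fun i => ?_) l
    · simp [hg, div_mul_cancel₀ M' hM.ne']
    · simp [hg]
  exact markov_monotone hν₁ hw₁ (by omega) hgpos hgmono hx hy hmom hmom'' k

end Summit.Ventures.HSemireg.Wedge.HankelOuter
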